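import Summits.HubbardSuperconductivity.HubbardLadder.Bounds.StiffnessCeilingCurrentMoments
import HarnessLib

/-!
# Hubbard ladder — Bounds: the trial-direction (Hylleraas) sharpening of the stiffness ceiling
# (`t–t'` Hubbard class, `T = 0`; typed AND proved)

HONEST FRAMING (cell pub-hubbard): ladder R1–R4 with certified numbers; no claim on H/H₀. This is
a bound for a MODEL CLASS (the `t–t'` Hubbard torus `hubbardTorusTT' L 1 t' U` on `(ℤ/L)²`, every
`t'`, `U`, filling), no materials claim. Companion text: `pub-hubbard/paper/bounds.tex` Thm 5♯
(SHARPENING #7, "arbitrary trial direction"); table `pub-hubbard-bounds/BOUNDS.md` row T1f.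

## What is proved (no `sorry`, no new axioms)

`H = hubbardTorusTT' L 1 t' U`, `E(θ) = fluxEnergyTT' L t' U δ θ` (flux envelope of the sector
`(N_L, S^z = 0)`), `E₀ = E(0)`, `ψ` a unit zero-flux sector ground state, `K = kinOpTT' L t'`
(`Re⟨ψ, Kψ⟩ = 2 G₁(ψ)`, `G₁ = K_x + t' K_d`), `J = curOpTT' L t'` the `e₁`-current (part 1).

* `fluxEnergyTT'_trialDir_le` — the trial inequality of part 1 for `ψ + m η`, `η` an ARBITRARY
  sector vector (part 1 has `η = Jψ`).
* `TrialDirectionStiffnessCeilingTT'` (`@[conjecture] def`, PROVED): for `L ≥ 3`, every `t'`, `U`,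
  `δ`, `θ₀ > 0`, every real `ρ_s` with `ρ_s θ² ≤ E(θ) − E₀` on `|θ| ≤ θ₀`, every such `ψ` and
  EVERY sector vector `η`:  `ρ_s L² ≤ G₁(ψ) − 2 Re⟨η, Jψ⟩ + (Re⟨η, Hη⟩ − E₀ ‖η‖²)`, i.e. `G₁`
  plus the HYLLERAAS second-order functional `J_H[η] = ⟨η, (H − E₀)η⟩ − 2 Re⟨η, Jψ⟩` of the
  perturbation `J` (Hylleraas 1930; Epstein 1974 ch. VII §30 eqs. (17), (23)), whose infimum over
  the sector is `−⟨Jψ, (H − E₀)⁻¹ Jψ⟩` (the Kubo paramagnetic term `Λ_xx` of SWZ93) when `Jψ ⊥`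
  the sector ground space and `−∞` otherwise. No spectral decomposition, gap or non-degeneracy
  hypothesis: the bound is one-sided and exact at finite `L`.
* `currentMomentStiffnessCeilingTT'_of_trialDirection` — `η = μ • Jψ` gives back the landed
  `CurrentMomentStiffnessCeilingTT'` (bounds.tex Thm 5; `μ = 0`: the f-sum ceiling).
* `OptimalTrialDirectionCeilingTT'` (PROVED; optimal scaling): `0 ≤ B(η) := Re⟨η,Hη⟩ − E₀‖η‖²`
  and `ρ_s L² ≤ G₁(ψ) − (Re⟨η, Jψ⟩)²/B(η)` for every sector `η` (`x/0 = 0` covers `B = 0`).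
* `CurrentDecouplesGroundSpaceTT'` (PROVED): under the same hypothesis `⟨η, Jψ⟩ = 0` for EVERY
  sector ground state `η`; `NoGroundStateCurrentTT'` (PROVED; `η = ψ`): `⟨ψ, Jψ⟩ = 0` — a sector
  ground state with a two-sided quadratic flux response carries no `e₁`-current (conditional
  finite-volume Bloch theorem). Contrapositive: a ground multiplet carrying current matrix
  elements admits NO quadratic floor `ρ_s θ²` under `E(θ) − E₀`, for any real `ρ_s`.

Proof pattern (as in part 2): price `ψ ∓ sin(θ/L) η` at flux `±θ`, add (`E(−θ) = E(θ)`, odd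
terms cancel), multiply the stiffness hypothesis by the trial norm, let `θ → 0`.

References (keys of `lean/references.bib`): ScalapinoWhiteZhang1993 §II (`D = ⟨−k_x⟩ − Λ_xx`);
ParamekantiTrivediRanderia1998 eq. (3), §IV (gauge-function trial states = the directions
`η = i(Σ_x φ_x n_x)ψ`); HazraVermaRanderia2019 eqs. (2)–(4); Watanabe2019 §2.2; ByersYang1961.
Second-order variational principle: E. A. Hylleraas, Z. Phys. 65 (1930) 209; S. T. Epstein, The
Variation Method in Quantum Chemistry (Academic Press 1974), ch. VII §30.
-/

noncomputable section

namespace Summit.HubbardSuperconductivity.HubbardLadder.Bounds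

open Matrix Finset Real
open Literature.MathematicalPhysics.QuantumLattice
open Literature.MathematicalPhysics.QuantumFieldTheory
open Literature.Probability.LatticeModels
open scoped ComplexConjugate ComplexOrder

/-! ### Real scalings and the phase `i` in Hermitian forms -/

section General

variable {n : Type*} [Fintype n]

/-- `Re⟨μ φ, v⟩ = μ Re⟨φ, v⟩` for real `μ`. [folklore] -/
theorem re_star_ofReal_smul_dotProduct (μ : ℝ) (φ v : n → ℂ) :
    (star ((μ : ℂ) • φ) ⬝ᵥ v).re = μ * (star φ ⬝ᵥ v).re := by
  rw [star_smul, smul_dotProduct, Complex.star_def, Complex.conj_ofReal, smul_eq_mul,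
    Complex.re_ofReal_mul]

/-- `Re⟨μ φ, B (μ φ)⟩ = μ² Re⟨φ, B φ⟩` for real `μ`. [folklore] -/
theorem re_star_ofReal_smul_dotProduct_mulVec_smul (B : Matrix n n ℂ) (μ : ℝ) (φ : n → ℂ) :
    (star ((μ : ℂ) • φ) ⬝ᵥ (B *ᵥ ((μ : ℂ) • φ))).re = μ ^ 2 * (star φ ⬝ᵥ (B *ᵥ φ)).re := by
  rw [mulVec_smul, dotProduct_smul, smul_eq_mul, Complex.re_ofReal_mul,
    re_star_ofReal_smul_dotProduct, sq, mul_assoc]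

/-- `‖μ φ‖² = μ² ‖φ‖²` for real `μ` (real parts). [folklore] -/
theorem re_star_ofReal_smul_dotProduct_smul (μ : ℝ) (φ : n → ℂ) :
    (star ((μ : ℂ) • φ) ⬝ᵥ ((μ : ℂ) • φ)).re = μ ^ 2 * (star φ ⬝ᵥ φ).re := by
  rw [dotProduct_smul, smul_eq_mul, Complex.re_ofReal_mul, re_star_ofReal_smul_dotProduct, sq,
    mul_assoc]

/-- `Re⟨i φ, v⟩ = Im⟨φ, v⟩`. [folklore] -/
theorem re_star_I_smul_dotProduct (φ v : n → ℂ) :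
    (star (Complex.I • φ) ⬝ᵥ v).re = (star φ ⬝ᵥ v).im := by
  rw [star_smul, smul_dotProduct, Complex.star_def, Complex.conj_I, smul_eq_mul, neg_mul,
    Complex.neg_re, Complex.I_mul_re, neg_neg]

/-- `⟨i φ, B (i φ)⟩ = ⟨φ, B φ⟩`. [folklore] -/
theorem star_I_smul_dotProduct_mulVec_I_smul (B : Matrix n n ℂ) (φ : n → ℂ) :
    star (Complex.I • φ) ⬝ᵥ (B *ᵥ (Complex.I • φ)) = star φ ⬝ᵥ (B *ᵥ φ) := by
  rw [mulVec_smul, dotProduct_smul, star_smul, smul_dotProduct, Complex.star_def, Complex.conj_I,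
    smul_smul, mul_neg, Complex.I_mul_I, neg_neg, one_smul]

/-- `‖i φ‖² = ‖φ‖²`. [folklore] -/
theorem star_I_smul_dotProduct_I_smul (φ : n → ℂ) :
    star (Complex.I • φ) ⬝ᵥ (Complex.I • φ) = star φ ⬝ᵥ φ := by
  rw [dotProduct_smul, star_smul, smul_dotProduct, Complex.star_def, Complex.conj_I, smul_smul,
    mul_neg, Complex.I_mul_I, neg_neg, one_smul]

end General

variable {L : ℕ} [NeZero L]

/-! ### The trial state `ψ + m η` at flux `θ`, arbitrary sector direction `η` -/

/-- **The trial inequality, arbitrary direction**: for a unit zero-flux sector ground state `ψ`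
(energy `E₀ = E(0)`), a sector vector `η` and real `m`, pricing `χ = ψ + m η` at flux `θ` gives
`E(θ)(1 + 2m Re⟨η,ψ⟩ + m²‖η‖²) ≤ E₀(1 + 2m Re⟨η,ψ⟩ + m²‖η‖²) + m²(Re⟨η,Hη⟩ − E₀‖η‖²)
  + (1 − cos(θ/L))(Re⟨ψ,Kψ⟩ + 2m Re⟨η,Kψ⟩ + m² Re⟨η,Kη⟩)
  + sin(θ/L)(Re⟨ψ,Jψ⟩ + 2m Re⟨η,Jψ⟩ + m² Re⟨η,Jη⟩)`
(`Re⟨η, Hψ⟩ = E₀ Re⟨η, ψ⟩`). The case `η = Jψ` is `fluxEnergyTT'_trial_le`.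
[cite: HazraVermaRanderia2019, eqs. (2)–(4)] -/
theorem fluxEnergyTT'_trialDir_le (hL : 3 ≤ L) (t' U δ θ m : ℝ)
    {ψ η : Fock (Orb (FermionTorus 2 L))}
    (hgs : IsGroundStateInSector (hubbardTorusTT' L 1 t' U) (2 * ⌊(1 - δ) * (L : ℝ) ^ 2 / 2⌋₊) 0 ψ)
    (h1 : star ψ ⬝ᵥ ψ = 1) (hη : η ∈ szSector (2 * ⌊(1 - δ) * (L : ℝ) ^ 2 / 2⌋₊) 0) :
    fluxEnergyTT' L t' U δ θ *
        (1 + 2 * m * (star η ⬝ᵥ ψ).re + m ^ 2 * (star η ⬝ᵥ η).re) ≤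
      fluxEnergyTT' L t' U δ 0 *
          (1 + 2 * m * (star η ⬝ᵥ ψ).re + m ^ 2 * (star η ⬝ᵥ η).re) +
        m ^ 2 * ((star η ⬝ᵥ (hubbardTorusTT' L 1 t' U *ᵥ η)).re -
          fluxEnergyTT' L t' U δ 0 * (star η ⬝ᵥ η).re) +
        (1 - Real.cos (θ / L)) *
          ((star ψ ⬝ᵥ (kinOpTT' L t' *ᵥ ψ)).re +
            2 * m * (star η ⬝ᵥ (kinOpTT' L t' *ᵥ ψ)).re +
            m ^ 2 * (star η ⬝ᵥ (kinOpTT' L t' *ᵥ η)).re) +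
        Real.sin (θ / L) *
          ((star ψ ⬝ᵥ (curOpTT' L t' *ᵥ ψ)).re +
            2 * m * (star η ⬝ᵥ (curOpTT' L t' *ᵥ ψ)).re +
            m ^ 2 * (star η ⬝ᵥ (curOpTT' L t' *ᵥ η)).re) := by
  have hE : (star ψ ⬝ᵥ (hubbardTorusTT' L 1 t' U *ᵥ ψ)).re = fluxEnergyTT' L t' U δ 0 :=
    re_star_dotProduct_mulVec_eq_fluxEnergyTT'_zero t' U δ hgs h1
  obtain ⟨hψS, -, hHψ⟩ := hgs
  have hE0 : (hubbardTorusTT' L 1 t' U).minEnergyOn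
      (szSector (2 * ⌊(1 - δ) * (L : ℝ) ^ 2 / 2⌋₊) 0) = fluxEnergyTT' L t' U δ 0 := by
    rw [fluxEnergyTT'_eq, hubbardTorusTT'Flux_zero]
  rw [hE0] at hHψ
  have hηH : (star η ⬝ᵥ (hubbardTorusTT' L 1 t' U *ᵥ ψ)).re =
      fluxEnergyTT' L t' U δ 0 * (star η ⬝ᵥ ψ).re := by
    rw [hHψ, dotProduct_smul, smul_eq_mul, Complex.re_ofReal_mul]
  have h1re : (star ψ ⬝ᵥ ψ).re = 1 := by rw [h1, Complex.one_re]
  have hχS : ψ + (m : ℂ) • η ∈ szSector (2 * ⌊(1 - δ) * (L : ℝ) ^ 2 / 2⌋₊) 0 :=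
    Submodule.add_mem _ hψS (Submodule.smul_mem _ _ hη)
  have hray := fluxEnergyTT'_mul_normSq_le hL t' U δ θ hχS
  rw [re_uniformTwistTT'_eq_kin_cur hL, re_normSq_add_smul,
    re_quadForm_add_smul (hubbardTorusTT'_isHermitian L 1 t' U),
    re_quadForm_add_smul (isHermitian_kinOpTT' t'), re_quadForm_add_smul (isHermitian_curOpTT' t'),
    h1re, hE, hηH] at hray
  linarith

/-- **The trial-direction stiffness ceiling for the `t–t'` class** (bounds.tex Thm 5♯;
SHARPENING #7): for `L ≥ 3`, every `t'`, `U`, `δ`, every `θ₀ > 0` and every real `ρ_s` with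
`ρ_s θ² ≤ E^{tt'}_L(θ) − E^{tt'}_L(0)` for `|θ| ≤ θ₀`, every unit zero-flux `(N_L, 0)`-sector ground
state `ψ` of `H = hubbardTorusTT' L 1 t' U` and EVERY vector `η` of that sector satisfy
`ρ_s L² ≤ (K_x + t' K_d)(ψ) − 2 Re⟨η, Jψ⟩ + (Re⟨η, Hη⟩ − E(0)‖η‖²)`, `J = curOpTT' L t'` —
the f-sum ceiling plus the Hylleraas functional of the trial first-order vector `η`. PROVED below
(`trialDirectionStiffnessCeilingTT'_holds`). -/
@[conjecture] def TrialDirectionStiffnessCeilingTT' : Prop :=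
  ∀ (L : ℕ) [NeZero L], 3 ≤ L → ∀ (t' U δ ρs θ₀ : ℝ), 0 < θ₀ →
    (∀ θ : ℝ, |θ| ≤ θ₀ → ρs * θ ^ 2 ≤ fluxEnergyTT' L t' U δ θ - fluxEnergyTT' L t' U δ 0) →
    ∀ ψ : Fock (Orb (FermionTorus 2 L)),
      IsGroundStateInSector (hubbardTorusTT' L 1 t' U) (2 * ⌊(1 - δ) * (L : ℝ) ^ 2 / 2⌋₊) 0 ψ →
      star ψ ⬝ᵥ ψ = 1 → ∀ η : Fock (Orb (FermionTorus 2 L)),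
      η ∈ szSector (2 * ⌊(1 - δ) * (L : ℝ) ^ 2 / 2⌋₊) 0 →
      ρs * (L : ℝ) ^ 2 ≤
        ((∑ x : Site 2 L, ∑ σ : Fin 2,
            (star ψ ⬝ᵥ ((creation (orb (FermionTorus.ofTorusSite (Site.shift x 0)) σ) *
              annihilation (orb (FermionTorus.ofTorusSite x) σ)) *ᵥ ψ)).re) +
          t' * ∑ s : Fin 2, ∑ x : Site 2 L, ∑ σ : Fin 2,
            (star ψ ⬝ᵥ ((creation (orb (FermionTorus.ofTorusSite (x + torusDiagJump L s)) σ) *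
              annihilation (orb (FermionTorus.ofTorusSite x) σ)) *ᵥ ψ)).re) -
        2 * (star η ⬝ᵥ (curOpTT' L t' *ᵥ ψ)).re +
        ((star η ⬝ᵥ (hubbardTorusTT' L 1 t' U *ᵥ η)).re -
          fluxEnergyTT' L t' U δ 0 * (star η ⬝ᵥ η).re)

/-- **`TrialDirectionStiffnessCeilingTT'` holds.** Proof: the trial inequality at `(θ, m)` and at
`(−θ, −m)` with `m = −sin(θ/L)`, `E(−θ) = E(θ)`; the odd terms cancel, leaving
`ρ_s θ² ≤ (1 − cos(θ/L)) Re⟨ψ,Kψ⟩ + sin²(θ/L)(B(η) − 2 Re⟨η,Jψ⟩) + O(θ⁴)`; then `θ → 0`. -/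
theorem trialDirectionStiffnessCeilingTT'_holds : TrialDirectionStiffnessCeilingTT' := by
  intro L _ hL t' U δ ρs θ₀ hθ₀ hstiff ψ hgs h1 η hη
  have hL0 : (0 : ℝ) < L := Nat.cast_pos.2 (NeZero.pos L)
  have hK := re_star_dotProduct_kinOpTT'_mulVec t' ψ
  have ha0 : 0 ≤ (star η ⬝ᵥ η).re := (Complex.nonneg_iff.1 (dotProduct_star_self_nonneg _)).1
  have hT := fun θ m => fluxEnergyTT'_trialDir_le hL t' U δ θ m hgs h1 hη
  generalize ha : (star η ⬝ᵥ η).re = a at hT ha0 ⊢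
  generalize hr : (star η ⬝ᵥ ψ).re = r at hT
  generalize hηH : (star η ⬝ᵥ (hubbardTorusTT' L 1 t' U *ᵥ η)).re = ηH at hT ⊢
  generalize hk₁ : (star η ⬝ᵥ (kinOpTT' L t' *ᵥ ψ)).re = k₁ at hT
  generalize hκ : (star η ⬝ᵥ (kinOpTT' L t' *ᵥ η)).re = κ at hT
  generalize hjη : (star η ⬝ᵥ (curOpTT' L t' *ᵥ η)).re = jη at hT
  generalize hj₁ : (star η ⬝ᵥ (curOpTT' L t' *ᵥ ψ)).re = j₁ at hT ⊢
  generalize hj₀ : (star ψ ⬝ᵥ (curOpTT' L t' *ᵥ ψ)).re = j₀ at hT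
  generalize hk₀ : (star ψ ⬝ᵥ (kinOpTT' L t' *ᵥ ψ)).re = k₀ at hT hK
  generalize hE₀ : fluxEnergyTT' L t' U δ 0 = E₀ at hT hstiff ⊢
  have hmain : ρs * (L : ℝ) ^ 2 ≤ k₀ / 2 + ((ηH - E₀ * a) - 2 * j₁) := by
    refine mul_sq_le_of_forall_flux hL0 hθ₀
      (G := |κ| / (2 * (L : ℝ) ^ 4) + |ρs| * a / (L : ℝ) ^ 2) (by positivity)
      fun θ hθ hθ₁ => ?_
    have hθabs : |θ| ≤ θ₀ := by rw [abs_of_pos hθ]; exact hθ₁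
    have hst := hstiff θ hθabs
    have hp := hT θ (-Real.sin (θ / L))
    have hm := hT (-θ) (Real.sin (θ / L))
    rw [neg_div, Real.cos_neg, Real.sin_neg, fluxEnergyTT'_neg] at hm
    have hc0 : 0 ≤ 1 - Real.cos (θ / L) := sub_nonneg.2 (Real.cos_le_one _)
    have hc2 : 1 - Real.cos (θ / L) ≤ (θ / L) ^ 2 / 2 := by
      linarith [Real.one_sub_sq_div_two_le_cos (x := θ / L)]
    have hs2 : Real.sin (θ / L) ^ 2 ≤ (θ / L) ^ 2 :=
      Literature.Probability.LatticeModels.sin_sq_le_sq _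
    have hm0 : 0 ≤ 1 + Real.sin (θ / L) ^ 2 * a := by positivity
    have hmul := mul_le_mul_of_nonneg_right hst hm0
    have hcomb : ρs * θ ^ 2 * (1 + Real.sin (θ / L) ^ 2 * a) ≤
        Real.sin (θ / L) ^ 2 * (ηH - E₀ * a) +
          (1 - Real.cos (θ / L)) * (k₀ + Real.sin (θ / L) ^ 2 * κ) -
          2 * Real.sin (θ / L) ^ 2 * j₁ := by
      linarith
    have hY : (1 - Real.cos (θ / L)) * κ - ρs * θ ^ 2 * a ≤
        (θ / L) ^ 2 / 2 * |κ| + |ρs| * θ ^ 2 * a := by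
      have e1 : (1 - Real.cos (θ / L)) * κ ≤ (θ / L) ^ 2 / 2 * |κ| :=
        (mul_le_mul_of_nonneg_left (le_abs_self κ) hc0).trans
          (mul_le_mul_of_nonneg_right hc2 (abs_nonneg κ))
      have e2 : -(ρs * θ ^ 2 * a) ≤ |ρs| * θ ^ 2 * a :=
        calc -(ρs * θ ^ 2 * a) = (-ρs) * (θ ^ 2 * a) := by ring
          _ ≤ |ρs| * (θ ^ 2 * a) :=
              mul_le_mul_of_nonneg_right (neg_le_abs ρs) (mul_nonneg (sq_nonneg θ) ha0)
          _ = |ρs| * θ ^ 2 * a := by ring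
      linarith
    have hY0 : 0 ≤ (θ / L) ^ 2 / 2 * |κ| + |ρs| * θ ^ 2 * a := by positivity
    have hG : Real.sin (θ / L) ^ 2 * ((1 - Real.cos (θ / L)) * κ - ρs * θ ^ 2 * a) ≤
        (|κ| / (2 * (L : ℝ) ^ 4) + |ρs| * a / (L : ℝ) ^ 2) * θ ^ 4 :=
      calc Real.sin (θ / L) ^ 2 * ((1 - Real.cos (θ / L)) * κ - ρs * θ ^ 2 * a)
          ≤ Real.sin (θ / L) ^ 2 * ((θ / L) ^ 2 / 2 * |κ| + |ρs| * θ ^ 2 * a) :=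
            mul_le_mul_of_nonneg_left hY (sq_nonneg _)
        _ ≤ (θ / L) ^ 2 * ((θ / L) ^ 2 / 2 * |κ| + |ρs| * θ ^ 2 * a) :=
            mul_le_mul_of_nonneg_right hs2 hY0
        _ = (|κ| / (2 * (L : ℝ) ^ 4) + |ρs| * a / (L : ℝ) ^ 2) * θ ^ 4 := by
            field_simp
    linarith
  rw [hK] at hmain
  linarith

/-! ### Corollaries -/

/-- **`η = μ Jψ` returns the current-moment ceiling** (bounds.tex Thm 5 ⇐ Thm 5♯): the landed
node `CurrentMomentStiffnessCeilingTT'` (part 2) follows from `TrialDirectionStiffnessCeilingTT'`.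
[cite: ScalapinoWhiteZhang1993, §II] -/
theorem currentMomentStiffnessCeilingTT'_of_trialDirection (h : TrialDirectionStiffnessCeilingTT') :
    CurrentMomentStiffnessCeilingTT' := by
  intro L _ hL t' U δ ρs θ₀ hθ₀ hstiff ψ hgs h1 μ
  have hφS : (μ : ℂ) • (curOpTT' L t' *ᵥ ψ) ∈ szSector (2 * ⌊(1 - δ) * (L : ℝ) ^ 2 / 2⌋₊) 0 :=
    Submodule.smul_mem _ _
      (mulVec_mem_szSector_of_preservesSectors (preservesSectors_curOpTT' t') hgs.1)
  have hη := h L hL t' U δ ρs θ₀ hθ₀ hstiff ψ hgs h1 _ hφS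
  rw [re_star_ofReal_smul_dotProduct, re_star_ofReal_smul_dotProduct_mulVec_smul,
    re_star_ofReal_smul_dotProduct_smul] at hη
  linarith

/-- **`B(η) ≥ 0`**: `E(0) ‖η‖² ≤ Re⟨η, H η⟩` for every sector vector `η` (`E(0)` is the sector
minimum). [cite: ScalapinoWhiteZhang1993, §II] -/
theorem fluxEnergyTT'_zero_mul_normSq_le (t' U δ : ℝ) {η : Fock (Orb (FermionTorus 2 L))}
    (hη : η ∈ szSector (2 * ⌊(1 - δ) * (L : ℝ) ^ 2 / 2⌋₊) 0) :
    fluxEnergyTT' L t' U δ 0 * (star η ⬝ᵥ η).re ≤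
      (star η ⬝ᵥ (hubbardTorusTT' L 1 t' U *ᵥ η)).re := by
  rw [fluxEnergyTT'_eq, hubbardTorusTT'Flux_zero]
  exact minEnergyOn_mul_re_le (hubbardTorusTT'_isHermitian L 1 t' U) _ hη

/-- **The optimally scaled trial direction** (`@[conjecture] def`, PROVED by
`optimalTrialDirectionCeilingTT'_holds`; bounds.tex Thm 5♯(ii)): with `A(η) = Re⟨η, Jψ⟩`,
`B(η) = Re⟨η, Hη⟩ − E(0)‖η‖²`, every sector flux stiffness `ρ_s`, every unit zero-flux sector
ground state `ψ` and EVERY sector vector `η` satisfy `0 ≤ B(η)` AND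
`ρ_s L² ≤ (K_x + t' K_d)(ψ) − A(η)²/B(η)` (the Hylleraas lower bound on the paramagnetic term;
`x/0 = 0` covers `B = 0`; `η = Jψ` is `OptimalCurrentMomentCeilingTT'`). -/
@[conjecture] def OptimalTrialDirectionCeilingTT' : Prop :=
  ∀ (L : ℕ) [NeZero L], 3 ≤ L → ∀ (t' U δ ρs θ₀ : ℝ), 0 < θ₀ →
    (∀ θ : ℝ, |θ| ≤ θ₀ → ρs * θ ^ 2 ≤ fluxEnergyTT' L t' U δ θ - fluxEnergyTT' L t' U δ 0) →
    ∀ ψ : Fock (Orb (FermionTorus 2 L)),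
      IsGroundStateInSector (hubbardTorusTT' L 1 t' U) (2 * ⌊(1 - δ) * (L : ℝ) ^ 2 / 2⌋₊) 0 ψ →
      star ψ ⬝ᵥ ψ = 1 → ∀ η : Fock (Orb (FermionTorus 2 L)),
      η ∈ szSector (2 * ⌊(1 - δ) * (L : ℝ) ^ 2 / 2⌋₊) 0 →
      0 ≤ (star η ⬝ᵥ (hubbardTorusTT' L 1 t' U *ᵥ η)).re -
          fluxEnergyTT' L t' U δ 0 * (star η ⬝ᵥ η).re ∧
      ρs * (L : ℝ) ^ 2 ≤
        ((∑ x : Site 2 L, ∑ σ : Fin 2,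
            (star ψ ⬝ᵥ ((creation (orb (FermionTorus.ofTorusSite (Site.shift x 0)) σ) *
              annihilation (orb (FermionTorus.ofTorusSite x) σ)) *ᵥ ψ)).re) +
          t' * ∑ s : Fin 2, ∑ x : Site 2 L, ∑ σ : Fin 2,
            (star ψ ⬝ᵥ ((creation (orb (FermionTorus.ofTorusSite (x + torusDiagJump L s)) σ) *
              annihilation (orb (FermionTorus.ofTorusSite x) σ)) *ᵥ ψ)).re) -
        (star η ⬝ᵥ (curOpTT' L t' *ᵥ ψ)).re ^ 2 /
          ((star η ⬝ᵥ (hubbardTorusTT' L 1 t' U *ᵥ η)).re -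
            fluxEnergyTT' L t' U δ 0 * (star η ⬝ᵥ η).re)

/-- **`OptimalTrialDirectionCeilingTT'` holds** (`η ↦ (A/B) • η` in
`TrialDirectionStiffnessCeilingTT'`; `B ≥ 0` by `fluxEnergyTT'_zero_mul_normSq_le`). -/
theorem optimalTrialDirectionCeilingTT'_holds : OptimalTrialDirectionCeilingTT' := by
  intro L _ hL t' U δ ρs θ₀ hθ₀ hstiff ψ hgs h1 η hη
  refine ⟨sub_nonneg.2 (fluxEnergyTT'_zero_mul_normSq_le t' U δ hη), ?_⟩
  have h := fun μ : ℝ => trialDirectionStiffnessCeilingTT'_holds L hL t' U δ ρs θ₀ hθ₀ hstiff ψ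
    hgs h1 ((μ : ℂ) • η) (Submodule.smul_mem _ _ hη)
  simp only [re_star_ofReal_smul_dotProduct_mulVec_smul, re_star_ofReal_smul_dotProduct_smul] at h
  simp only [re_star_ofReal_smul_dotProduct] at h
  generalize (star η ⬝ᵥ (curOpTT' L t' *ᵥ ψ)).re = A at h ⊢
  generalize (star η ⬝ᵥ (hubbardTorusTT' L 1 t' U *ᵥ η)).re = ηH at h ⊢
  generalize (star η ⬝ᵥ η).re = a at h ⊢
  generalize fluxEnergyTT' L t' U δ 0 = E₀ at h ⊢
  by_cases hb : ηH - E₀ * a = 0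
  · have h0 := h 0
    rw [hb, div_zero]
    linarith
  · have hμ := h (A / (ηH - E₀ * a))
    have hid : -(2 * (A / (ηH - E₀ * a) * A)) +
        ((A / (ηH - E₀ * a)) ^ 2 * ηH - E₀ * ((A / (ηH - E₀ * a)) ^ 2 * a)) =
        -(A ^ 2 / (ηH - E₀ * a)) := by
      field_simp
      ring
    linarith

/-- **The current decouples the sector ground space** (`@[conjecture] def`, PROVED by
`currentDecouplesGroundSpaceTT'_holds`; bounds.tex Thm 5♯(iii)): if the `(N_L, 0)`-sector flux
curve has a two-sided quadratic floor `ρ_s θ² ≤ E(θ) − E(0)` (`|θ| ≤ θ₀`, any real `ρ_s`), then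
`⟨η, Jψ⟩ = 0` for every unit zero-flux sector ground state `ψ` and EVERY sector ground state `η`
(so the infimum of the Hylleraas functional is the finite Kubo term). -/
@[conjecture] def CurrentDecouplesGroundSpaceTT' : Prop :=
  ∀ (L : ℕ) [NeZero L], 3 ≤ L → ∀ (t' U δ ρs θ₀ : ℝ), 0 < θ₀ →
    (∀ θ : ℝ, |θ| ≤ θ₀ → ρs * θ ^ 2 ≤ fluxEnergyTT' L t' U δ θ - fluxEnergyTT' L t' U δ 0) →
    ∀ ψ : Fock (Orb (FermionTorus 2 L)),
      IsGroundStateInSector (hubbardTorusTT' L 1 t' U) (2 * ⌊(1 - δ) * (L : ℝ) ^ 2 / 2⌋₊) 0 ψ →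
      star ψ ⬝ᵥ ψ = 1 → ∀ η : Fock (Orb (FermionTorus 2 L)),
      IsGroundStateInSector (hubbardTorusTT' L 1 t' U) (2 * ⌊(1 - δ) * (L : ℝ) ^ 2 / 2⌋₊) 0 η →
      star η ⬝ᵥ (curOpTT' L t' *ᵥ ψ) = 0

/-- A sector vector `η` with `Re⟨η, Hη⟩ = E(0)‖η‖²` (a ground vector) has `Re⟨η, Jψ⟩ = 0` under
the two-sided quadratic flux hypothesis (`η ↦ λ • η` in the ceiling, `λ → ±∞`). [folklore] -/
theorem re_star_dotProduct_curOpTT'_mulVec_eq_zero (hL : 3 ≤ L) {t' U δ ρs θ₀ : ℝ} (hθ₀ : 0 < θ₀)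
    (hstiff : ∀ θ : ℝ, |θ| ≤ θ₀ →
      ρs * θ ^ 2 ≤ fluxEnergyTT' L t' U δ θ - fluxEnergyTT' L t' U δ 0)
    {ψ η : Fock (Orb (FermionTorus 2 L))}
    (hgs : IsGroundStateInSector (hubbardTorusTT' L 1 t' U) (2 * ⌊(1 - δ) * (L : ℝ) ^ 2 / 2⌋₊) 0 ψ)
    (h1 : star ψ ⬝ᵥ ψ = 1) (hη : η ∈ szSector (2 * ⌊(1 - δ) * (L : ℝ) ^ 2 / 2⌋₊) 0)
    (hB : (star η ⬝ᵥ (hubbardTorusTT' L 1 t' U *ᵥ η)).re =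
      fluxEnergyTT' L t' U δ 0 * (star η ⬝ᵥ η).re) :
    (star η ⬝ᵥ (curOpTT' L t' *ᵥ ψ)).re = 0 := by
  have h := fun μ : ℝ => trialDirectionStiffnessCeilingTT'_holds L hL t' U δ ρs θ₀ hθ₀ hstiff ψ
    hgs h1 ((μ : ℂ) • η) (Submodule.smul_mem _ _ hη)
  simp only [re_star_ofReal_smul_dotProduct_mulVec_smul, re_star_ofReal_smul_dotProduct_smul,
    hB] at h
  simp only [re_star_ofReal_smul_dotProduct] at h
  generalize (star η ⬝ᵥ (curOpTT' L t' *ᵥ ψ)).re = A at h ⊢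
  generalize ((∑ x : Site 2 L, ∑ σ : Fin 2,
      (star ψ ⬝ᵥ ((creation (orb (FermionTorus.ofTorusSite (Site.shift x 0)) σ) *
        annihilation (orb (FermionTorus.ofTorusSite x) σ)) *ᵥ ψ)).re) +
    t' * ∑ s : Fin 2, ∑ x : Site 2 L, ∑ σ : Fin 2,
      (star ψ ⬝ᵥ ((creation (orb (FermionTorus.ofTorusSite (x + torusDiagJump L s)) σ) *
        annihilation (orb (FermionTorus.ofTorusSite x) σ)) *ᵥ ψ)).re) = G₁ at h
  by_contra hA
  have hμ := h ((G₁ - ρs * (L : ℝ) ^ 2 + 1) / (2 * A))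
  have hid : 2 * ((G₁ - ρs * (L : ℝ) ^ 2 + 1) / (2 * A) * A) = G₁ - ρs * (L : ℝ) ^ 2 + 1 := by
    field_simp
  linarith [hμ, hid]

/-- **`CurrentDecouplesGroundSpaceTT'` holds** (real part from
`re_star_dotProduct_curOpTT'_mulVec_eq_zero` at `η`, imaginary part at `i • η`). -/
theorem currentDecouplesGroundSpaceTT'_holds : CurrentDecouplesGroundSpaceTT' := by
  intro L _ hL t' U δ ρs θ₀ hθ₀ hstiff ψ hgs h1 η hgsη
  obtain ⟨hηS, -, hHη⟩ := hgsη
  have hE0 : (hubbardTorusTT' L 1 t' U).minEnergyOn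
      (szSector (2 * ⌊(1 - δ) * (L : ℝ) ^ 2 / 2⌋₊) 0) = fluxEnergyTT' L t' U δ 0 := by
    rw [fluxEnergyTT'_eq, hubbardTorusTT'Flux_zero]
  rw [hE0] at hHη
  have hB : (star η ⬝ᵥ (hubbardTorusTT' L 1 t' U *ᵥ η)).re =
      fluxEnergyTT' L t' U δ 0 * (star η ⬝ᵥ η).re := by
    rw [hHη, dotProduct_smul, smul_eq_mul, Complex.re_ofReal_mul]
  have hBI : (star (Complex.I • η) ⬝ᵥ (hubbardTorusTT' L 1 t' U *ᵥ (Complex.I • η))).re =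
      fluxEnergyTT' L t' U δ 0 * (star (Complex.I • η) ⬝ᵥ (Complex.I • η)).re := by
    rw [star_I_smul_dotProduct_mulVec_I_smul, star_I_smul_dotProduct_I_smul, hB]
  have hre := re_star_dotProduct_curOpTT'_mulVec_eq_zero hL hθ₀ hstiff hgs h1 hηS hB
  have him := re_star_dotProduct_curOpTT'_mulVec_eq_zero hL hθ₀ hstiff hgs h1
    (Submodule.smul_mem _ _ hηS) hBI
  rw [re_star_I_smul_dotProduct] at him
  exact Complex.ext hre him

/-- **No ground-state current** (`@[conjecture] def`, PROVED by `noGroundStateCurrentTT'_holds`;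
`η = ψ` in `CurrentDecouplesGroundSpaceTT'`): a unit zero-flux `(N_L, 0)`-sector ground state `ψ`
whose sector flux curve has a two-sided quadratic floor `ρ_s θ² ≤ E(θ) − E(0)` (`|θ| ≤ θ₀`, any
real `ρ_s`) carries no `e₁`-current: `⟨ψ, Jψ⟩ = 0` (conditional finite-volume Bloch theorem). -/
@[conjecture] def NoGroundStateCurrentTT' : Prop :=
  ∀ (L : ℕ) [NeZero L], 3 ≤ L → ∀ (t' U δ ρs θ₀ : ℝ), 0 < θ₀ →
    (∀ θ : ℝ, |θ| ≤ θ₀ → ρs * θ ^ 2 ≤ fluxEnergyTT' L t' U δ θ - fluxEnergyTT' L t' U δ 0) →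
    ∀ ψ : Fock (Orb (FermionTorus 2 L)),
      IsGroundStateInSector (hubbardTorusTT' L 1 t' U) (2 * ⌊(1 - δ) * (L : ℝ) ^ 2 / 2⌋₊) 0 ψ →
      star ψ ⬝ᵥ ψ = 1 → star ψ ⬝ᵥ (curOpTT' L t' *ᵥ ψ) = 0

/-- **`NoGroundStateCurrentTT'` holds** (`η = ψ` in `currentDecouplesGroundSpaceTT'_holds`). -/
theorem noGroundStateCurrentTT'_holds : NoGroundStateCurrentTT' :=
  fun L _ hL t' U δ ρs θ₀ hθ₀ hstiff ψ hgs h1 =>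
    currentDecouplesGroundSpaceTT'_holds L hL t' U δ ρs θ₀ hθ₀ hstiff ψ hgs h1 ψ hgs

end Summit.HubbardSuperconductivity.HubbardLadder.Bounds
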